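import Summits.HodgeConjecture.HodgeConjecture.Theorems.AlgebraicOrEnveloped.Negative.Calibration

/-!
# `AlgebraicOrEnveloped` (stmt-HodgeConjecture-14943) · Negative · line `Sketch` under HC

Negative knowledge for the PICKED line `Sketch` (idea hull-gysin-dichotomy) of the crux
`EndoscopicMiddleDegree.AlgebraicOrEnveloped` (route EndoscopicMiddleDegree, rev 11, rank 5), by the
standing disprover (refuter-cdisprove-stmt-HodgeConjecture-14943-0, cdisprove cycle 1, 2026-08-16; work
file `Cruxes/AlgebraicOrEnveloped/Disproof.lean` F4), companion of `Negative/Calibration` (§5: retract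
hulls kill the shadow kernel under HC).

THE REGISTERED STUBS OF THE LINE, VERBATIM (tree vocabulary, as spelled in
`Cruxes/AlgebraicOrEnveloped/Lines/Sketch.lean`), UNDER HC:

* `stub_shadowKernelEnveloped_of_hodgeConjecture` — HC ⟹ THE BET `stub_shadowKernelEnveloped`,
  VACUOUSLY: its shadow-kernel hypothesis (`ι_* e = 0` for every admissible `3(m+1)`-fold hull) forces
  `e = 0` under HC (retract hull `X ⊗ ℙ^{m+1}`, `Calibration.shadowKernel_eq_zero_of_hodgeConjecture`)
  and `γ = 0` envelopes `0` (`zero_enveloped`). So the bet is HC-implied exactly like the crux and admits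
  no refutation short of `¬HC` — no small model, no degenerate case
  (`not_hodgeConjecture_of_not_stub_shadowKernelEnveloped`).
* `hullShadowSplit_of_hodgeConjecture` — HC ⟹ the visible half `HullShadowSplit`, by `mem_sup_left`.
* `shadowKernel_generators_subset_zero_of_hodgeConjecture` — under HC every shadow-kernel generator of
  `HullShadowSplit` is `0`: the split degenerates to the target on `X`. The hulls add nothing LOGICALLY
  over the weaker residual "`e ⊥ Alg ⟹ enveloped`" (`AlgebraicKernelEnveloped` of the skeleton); they
  are the HANDLE by which the automorphic argument recognises `e` (Gysin-null in the modular hull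
  `Sh(U(3n,1))`, admissible by BMM Cor. 1.4 at `(p,n) = (3n,n)`, boundary included), not a source of
  strength — information for the lead, not a defect.

No `def`; axioms `propext`, `Classical.choice`, `Quot.sound`.

## References

* [Deligne2000] P. Deligne, The Hodge conjecture, Clay Mathematics Institute (2000), §1.
* [FultonYoungTableaux1997] W. Fulton, Young Tableaux, CUP 1997, App. B §B.1 (2), (5).
* [BergeronMillsonMoeglin2016Balls] N. Bergeron, J. Millson, C. Moeglin, arXiv:1306.1515, Cor. 1.4.
-/

noncomputable section

-- The mandated namespace `Summit.<P>.<Sub>.Theorems.…` repeats `HodgeConjecture` (single-conjunct summit).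
set_option linter.dupNamespace false

namespace Summit.HodgeConjecture.HodgeConjecture.Theorems.AlgebraicOrEnveloped.Negative.LineSketchUnderHC

open CategoryTheory MonoidalCategory CartesianMonoidalCategory
open Literature.AlgebraicGeometry Literature.AlgebraicGeometry.Motives
  Literature.AlgebraicGeometry.HodgeTheory Literature.AlgebraicGeometry.ShimuraVarieties
  Literature.AlgebraicTopology.SingularHomology
open Summit.HodgeConjecture.HodgeConjecture.Theorems.AlgebraicOrEnveloped.Negative.Calibration
  (shadowKernel_eq_zero_of_hodgeConjecture)

variable {m : ℕ} {X : SchemeOver ℂ}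

/-! ### The registered stubs of line `Sketch`, verbatim, under HC -/

/-- **The zero class is enveloped** (`γ = 0`, `P_0 = 0`, which preserves rational classes and has
`(n,n)` values as soon as a Hodge model exists) — why a vanishing shadow kernel makes the bet VACUOUS
rather than false. [folklore] -/
theorem zero_enveloped (μ : OrientationFamily) (hX : IsSmoothProjective (2 * (m + 1)) X)
    (A : HodgeModel (2 * (m + 1)) X) :
    ∃ γ ∈ algebraicClasses (X ⊗ X) (2 * (m + 1)),
      (∀ β, IsRationalClass β → IsRationalClass
        (corrAction μ hX hX
          (rfl : 2 * (m + 1) + 2 * (2 * (m + 1)) = 2 * (m + 1) + 2 * (2 * (m + 1))) γ β)) ∧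
      (∀ β, IsOfHodgeType (2 * (m + 1)) X (2 * (m + 1)) (m + 1) (m + 1)
        (corrAction μ hX hX
          (rfl : 2 * (m + 1) + 2 * (2 * (m + 1)) = 2 * (m + 1) + 2 * (2 * (m + 1))) γ β)) ∧
      corrAction μ hX hX
        (rfl : 2 * (m + 1) + 2 * (2 * (m + 1)) = 2 * (m + 1) + 2 * (2 * (m + 1))) γ 0 = 0 := by
  have h0 : corrAction μ hX hX
      (rfl : 2 * (m + 1) + 2 * (2 * (m + 1)) = 2 * (m + 1) + 2 * (2 * (m + 1)))
      (0 : complexBetti (X ⊗ X) (2 * (2 * (m + 1)))) = 0 := map_zero _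
  refine ⟨0, Submodule.zero_mem _, fun β _ ↦ ?_, fun β ↦ ?_, ?_⟩
  · rw [h0, LinearMap.zero_apply]; exact IsRationalClass.zero
  · rw [h0, LinearMap.zero_apply]; exact IsOfHodgeType.zero A _ _ _
  · rw [h0, LinearMap.zero_apply]

/-- **HC ⟹ `stub_shadowKernelEnveloped` (THE BET of line `Sketch`), vacuously.** The statement is the
registered stub's signature VERBATIM (crux workfile `Cruxes/AlgebraicOrEnveloped/Lines/Sketch.lean`;
tree vocabulary only): under HC its shadow-kernel hypothesis forces `e = 0`
(`shadowKernel_eq_zero_of_hodgeConjecture`, retract hull `X ⊗ ℙ^{m+1}`) and `γ = 0` envelopes `0`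
(`zero_enveloped`; the Hodge model comes from the hypothesis on `e`). So the bet is HC-implied exactly
like the crux: it admits no refutation short of `¬HC`, no small model, no degenerate case.
[cite: Deligne2000, §1] -/
theorem stub_shadowKernelEnveloped_of_hodgeConjecture (hHC : _root_.HodgeConjecture) :
    ∀ (μ : OrientationFamily), μ.HasPoincareDuality →
    ∀ (m : ℕ) (X : SchemeOver ℂ) (D : UnitaryBallQuotientDatum (2 * (m + 1)) X), 1 ≤ m → m ≤ 2 →
    (∀ a : complexBetti X (2 * m), IsRationalClass a →
      IsOfHodgeType (2 * (m + 1)) X (2 * m) m m a → a ∈ algebraicClasses X m) →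
    ∀ e : complexBetti X (2 * (m + 1)), IsRationalClass e →
      IsOfHodgeType (2 * (m + 1)) X (2 * (m + 1)) (m + 1) (m + 1) e →
      (∀ (X' : SchemeOver ℂ) (hX' : IsSmoothProjective (3 * (m + 1)) X') (ι : X ⟶ X'),
        (∀ a : complexBetti X' (2 * (m + 1)), IsRationalClass a →
          IsOfHodgeType (3 * (m + 1)) X' (2 * (m + 1)) (m + 1) (m + 1) a →
          a ∈ algebraicClasses X' (m + 1)) →
        complexGysin μ D.isSmoothProjective hX' ι
          (show 2 * (m + 1) + 2 * (3 * (m + 1)) = 2 * (2 * (m + 1)) + 2 * (2 * (m + 1)) by ring) e = 0) →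
      ∃ γ ∈ algebraicClasses (X ⊗ X) (2 * (m + 1)),
        (∀ β, IsRationalClass β → IsRationalClass
          (complexGysin μ
            (IsSmoothProjective.tensor_holds D.isSmoothProjective D.isSmoothProjective)
            D.isSmoothProjective (fst X X)
            (show 2 * (m + 1) + 2 * (2 * (m + 1)) + 2 * (2 * (m + 1)) =
              2 * (m + 1) + 2 * (2 * (m + 1) + 2 * (m + 1)) by ring)
            (cupProduct (rfl : 2 * (m + 1) + 2 * (2 * (m + 1)) = 2 * (m + 1) + 2 * (2 * (m + 1)))
              (complexBetti.map (snd X X) (2 * (m + 1)) β) γ))) ∧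
        (∀ β, IsOfHodgeType (2 * (m + 1)) X (2 * (m + 1)) (m + 1) (m + 1)
          (complexGysin μ
            (IsSmoothProjective.tensor_holds D.isSmoothProjective D.isSmoothProjective)
            D.isSmoothProjective (fst X X)
            (show 2 * (m + 1) + 2 * (2 * (m + 1)) + 2 * (2 * (m + 1)) =
              2 * (m + 1) + 2 * (2 * (m + 1) + 2 * (m + 1)) by ring)
            (cupProduct (rfl : 2 * (m + 1) + 2 * (2 * (m + 1)) = 2 * (m + 1) + 2 * (2 * (m + 1)))
              (complexBetti.map (snd X X) (2 * (m + 1)) β) γ))) ∧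
        (complexGysin μ
            (IsSmoothProjective.tensor_holds D.isSmoothProjective D.isSmoothProjective)
            D.isSmoothProjective (fst X X)
            (show 2 * (m + 1) + 2 * (2 * (m + 1)) + 2 * (2 * (m + 1)) =
              2 * (m + 1) + 2 * (2 * (m + 1) + 2 * (m + 1)) by ring)
            (cupProduct (rfl : 2 * (m + 1) + 2 * (2 * (m + 1)) = 2 * (m + 1) + 2 * (2 * (m + 1)))
              (complexBetti.map (snd X X) (2 * (m + 1)) e) γ)) = e := by
  intro μ _ m X D _ _ _ e _ heH hsh
  obtain rfl : e = 0 := shadowKernel_eq_zero_of_hodgeConjecture hHC μ D.isSmoothProjective hsh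
  obtain ⟨A, _⟩ := heH
  exact zero_enveloped μ D.isSmoothProjective A

/-- **HC ⟹ the visible half `HullShadowSplit` of line `Sketch`** (its statement verbatim, shadow
kernel unfolded), by `Submodule.mem_sup_left` — target-implied like the crux. [cite: Deligne2000, §1] -/
theorem hullShadowSplit_of_hodgeConjecture (hHC : _root_.HodgeConjecture) :
    ∀ (m : ℕ) (X : SchemeOver ℂ) (D : UnitaryBallQuotientDatum (2 * (m + 1)) X), 1 ≤ m → m ≤ 2 →
    (∀ a : complexBetti X (2 * m), IsRationalClass a →
      IsOfHodgeType (2 * (m + 1)) X (2 * m) m m a → a ∈ algebraicClasses X m) →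
    ∀ c : complexBetti X (2 * (m + 1)), IsRationalClass c →
      IsOfHodgeType (2 * (m + 1)) X (2 * (m + 1)) (m + 1) (m + 1) c →
      c ∈ algebraicClasses X (m + 1) ⊔ Submodule.span ℂ {e : complexBetti X (2 * (m + 1)) |
        IsRationalClass e ∧ IsOfHodgeType (2 * (m + 1)) X (2 * (m + 1)) (m + 1) (m + 1) e ∧
        ∃ μ : OrientationFamily, μ.HasPoincareDuality ∧
          ∀ (X' : SchemeOver ℂ) (hX' : IsSmoothProjective (3 * (m + 1)) X') (ι : X ⟶ X'),
            (∀ a : complexBetti X' (2 * (m + 1)), IsRationalClass a →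
              IsOfHodgeType (3 * (m + 1)) X' (2 * (m + 1)) (m + 1) (m + 1) a →
              a ∈ algebraicClasses X' (m + 1)) →
            complexGysin μ D.isSmoothProjective hX' ι
              (show 2 * (m + 1) + 2 * (3 * (m + 1)) = 2 * (2 * (m + 1)) + 2 * (2 * (m + 1)) by ring)
              e = 0} :=
  fun _ _ D _ _ _ c hc hH ↦ Submodule.mem_sup_left ((hHC D.isSmoothProjective).2 _ c hc hH)

/-- **Under HC every shadow-kernel generator of `HullShadowSplit` is `0`**: the split degenerates to
`c ∈ algebraicClasses X (m+1)`, the target on `X`; the hulls add nothing logically over the weaker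
residual "`e ⊥ Alg ⟹ enveloped`" — they are the HANDLE for the automorphic recognition of `e`
(Gysin-null in the modular hull), not a source of strength. [cite: Deligne2000, §1] -/
theorem shadowKernel_generators_subset_zero_of_hodgeConjecture (hHC : _root_.HodgeConjecture)
    (m : ℕ) (X : SchemeOver ℂ) (hX : IsSmoothProjective (2 * (m + 1)) X) :
    {e : complexBetti X (2 * (m + 1)) |
        IsRationalClass e ∧ IsOfHodgeType (2 * (m + 1)) X (2 * (m + 1)) (m + 1) (m + 1) e ∧
        ∃ μ : OrientationFamily, μ.HasPoincareDuality ∧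
          ∀ (X' : SchemeOver ℂ) (hX' : IsSmoothProjective (3 * (m + 1)) X') (ι : X ⟶ X'),
            (∀ a : complexBetti X' (2 * (m + 1)), IsRationalClass a →
              IsOfHodgeType (3 * (m + 1)) X' (2 * (m + 1)) (m + 1) (m + 1) a →
              a ∈ algebraicClasses X' (m + 1)) →
            complexGysin μ hX hX' ι
              (show 2 * (m + 1) + 2 * (3 * (m + 1)) = 2 * (2 * (m + 1)) + 2 * (2 * (m + 1)) by ring)
              e = 0} ⊆ {0} := by
  rintro e ⟨-, -, μ, -, hsh⟩
  exact shadowKernel_eq_zero_of_hodgeConjecture hHC μ hX hsh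

/-- **Contrapositive for the lead**: if the bet (stub signature verbatim, `corrAction` spelling of the
conclusion) fails, HC fails. [cite: Deligne2000, §1] -/
theorem not_hodgeConjecture_of_not_stub_shadowKernelEnveloped
    (h : ¬ ∀ (μ : OrientationFamily), μ.HasPoincareDuality →
    ∀ (m : ℕ) (X : SchemeOver ℂ) (D : UnitaryBallQuotientDatum (2 * (m + 1)) X), 1 ≤ m → m ≤ 2 →
    (∀ a : complexBetti X (2 * m), IsRationalClass a →
      IsOfHodgeType (2 * (m + 1)) X (2 * m) m m a → a ∈ algebraicClasses X m) →
    ∀ e : complexBetti X (2 * (m + 1)), IsRationalClass e →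
      IsOfHodgeType (2 * (m + 1)) X (2 * (m + 1)) (m + 1) (m + 1) e →
      (∀ (X' : SchemeOver ℂ) (hX' : IsSmoothProjective (3 * (m + 1)) X') (ι : X ⟶ X'),
        (∀ a : complexBetti X' (2 * (m + 1)), IsRationalClass a →
          IsOfHodgeType (3 * (m + 1)) X' (2 * (m + 1)) (m + 1) (m + 1) a →
          a ∈ algebraicClasses X' (m + 1)) →
        complexGysin μ D.isSmoothProjective hX' ι
          (show 2 * (m + 1) + 2 * (3 * (m + 1)) = 2 * (2 * (m + 1)) + 2 * (2 * (m + 1)) by ring) e = 0) →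
      ∃ γ ∈ algebraicClasses (X ⊗ X) (2 * (m + 1)),
        (∀ β, IsRationalClass β → IsRationalClass
          (corrAction μ D.isSmoothProjective D.isSmoothProjective
            (rfl : 2 * (m + 1) + 2 * (2 * (m + 1)) = 2 * (m + 1) + 2 * (2 * (m + 1))) γ β)) ∧
        (∀ β, IsOfHodgeType (2 * (m + 1)) X (2 * (m + 1)) (m + 1) (m + 1)
          (corrAction μ D.isSmoothProjective D.isSmoothProjective
            (rfl : 2 * (m + 1) + 2 * (2 * (m + 1)) = 2 * (m + 1) + 2 * (2 * (m + 1))) γ β)) ∧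
        corrAction μ D.isSmoothProjective D.isSmoothProjective
          (rfl : 2 * (m + 1) + 2 * (2 * (m + 1)) = 2 * (m + 1) + 2 * (2 * (m + 1))) γ e = e) :
    ¬ _root_.HodgeConjecture :=
  fun hHC ↦ h (stub_shadowKernelEnveloped_of_hodgeConjecture hHC)

end Summit.HodgeConjecture.HodgeConjecture.Theorems.AlgebraicOrEnveloped.Negative.LineSketchUnderHC

end
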